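/-
Copyright (c) 2026. All rights reserved.
Released under Apache 2.0 license as described in the file LICENSE.
Authors: abc-iut cell, F-lane seat abc-iut-f-187 (gen 3), KEY INST59L2.
-/
import Literature.IUT.HodgeTheaters.TemperedCoveringsCor23Cor25ClosureCertificates
import Literature.IUT.HodgeTheaters.CommensuratorLemmas
import HarnessLib

/-!
# [IUTchI] Cor. 2.5 (inertia part): INSTANCE FORMS of the fact-list row `StableCurveTemperedData.Cor25Inertia`
# (F-2603) — the degenerate case `Π^tp_X = Π̂_X`, and a closed toy datum with a cusp (proof-only)

S. Mochizuki, *Inter-universal Teichmüller theory I*, §2, Corollary 2.5 p. 51 (Profinite Conjugates of Tempered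
Decomposition Groups), inertia part (the "resp." reading; by [IUTchII] Rmk. 2.5.2 the only part applied in [IUTchII]):
for `Σ̂ = Primes`, an inertia group in `Π̂_X` of a cusp is contained in `Π^tp_X` iff it is a `Π^tp_X`-conjugate of a
tempered cuspidal inertia group, and a `Π̂_X`-conjugate of `Π^tp_X` contains such an inertia group iff it equals
`Π^tp_X`. [claim: Mochizuki2012, status: disputed] (D-0012 claim key; nothing here bears on [IUTchIII] Cor. 3.12 or
asserts anything about abc.)

PROOF-ONLY companion (no `def`, no `instance`, no notation) of abc-iut-L5-t1's `TemperedCoverings.lean`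
(DEFINITION-FROZEN; imported, never edited), where the assertion is the `Prop`-valued structure `D.Cor25Inertia` on
an interface record `D : StableCurveTemperedData`.

Bookkeeping context (cell abc-iut, KEY row INST59L2).  The row is a SCHEMA over the interface: its universal closure
is REFUTED in the tree (`not_forall_cor25Inertia`, at the degenerate datum with NO cusps — clause two at `γ = 1` reads
«(∃ cusp …) ↔ True»; `TemperedCoveringsCor23Cor25ClosureCertificates.lean`), and its positive content sits behind
hypotheses (`cor25Inertia_of_prop24i`: [IUTchI] Prop. 2.4 (i) + `[Nonempty D.Cusp]` + a pro-`Σ` part of each `I_x`;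
`cor25Inertia_of_prop24i_of_equiv_zHat`).  The L-F kernel census found NO instance form.  This file supplies:

* `cor25Inertia_of_ιX_surjective` — WHICH degeneration makes the row hold outright: if the inclusion
  `ι : Π^tp_X ↪ Π̂_X` is ONTO (tempered = profinite — degenerate: for a hyperbolic curve `Π^tp_X ⊊ Π̂_X` is dense,
  never equal) and `X` has a cusp, then `D.Cor25Inertia` (every `Π̂_X`-conjugate is a `Π^tp_X`-conjugate);
  a hypothesis-bearing closer with NO deep input, complementing `not_cor25Inertia_of_isEmpty_cusp` (no cusps ⇒ false);
* `cor25Inertia_toyDatum` — **CLOSED INSTANCE, 0 binders, at a toy carrier LABELLED AS SUCH**: the closure refuter's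
  degenerate inhabitant (`Π^tp = Π̂ = ℤ/2ℤ` at graph and curve level, `ι = id`, discrete; `G_k = 1`; `Σ = {3}`,
  `Σ̂ = Primes`; `p = 2`; `Π^tp_ℍ = 1`, `Π̂_ℍ = ℤ/2ℤ`) but WITH ONE CUSP (`Cusp := PUnit`, `I_x := Δ^tp_X`) — exactly
  the clause whose absence the refuter exploits — satisfies `Cor25Inertia`, written out as a literal term;
* `exists_cor25Inertia_and_not_forall` — the R5 record: holds at the toy datum, fails universally.

HONEST LABEL: «INSTANCE at toy carrier» (DEGENERATE: `Π^tp_X = Π̂_X` finite); an instance-form theorem about OUR typed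
statement is not the printed corollary; the GENUINE instance (the tempered/profinite fundamental groups of a
pointed stable log curve, `StableCurveTemperedData.ofSpecialFibre`-shaped data with cusps) needs [IUTchI] Prop. 2.4 (i)
there and stays a NAMED input (`cor25Inertia_of_prop24i`).  Typed ≠ proved; refuted-as-schema ≠ refuted-in-print.
-/

namespace Literature.IUT.HodgeTheaters

namespace StableCurveTemperedData

open Pointwise

universe u

variable (D : StableCurveTemperedData.{u})

/-- **[IUTchI] Cor. 2.5 (inertia part) in the degenerate case `Π^tp_X = Π̂_X`**: if `ι : Π^tp_X → Π̂_X` is surjective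
and `X` has a cusp, `D.Cor25Inertia` holds — every `γ ∈ Π̂_X` is `ι t`, so a `Π̂_X`-conjugate of `I_x` is the
`Π^tp_X`-conjugate by `t` (`map_conj_smul`), and `γ · Π^tp_X · γ⁻¹ = Π^tp_X` (`Subgroup.conj_smul_eq_self_of_mem`).
DEGENERATE case (tempered = profinite); no deep input. [claim: Mochizuki2012, status: disputed] -/
theorem cor25Inertia_of_ιX_surjective (hι : Function.Surjective D.ιX) [Nonempty D.Cusp] :
    Literature.IUT.HodgeTheaters.StableCurveTemperedData.Cor25Inertia D where
  le_iff _ x γ := by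
    constructor
    · intro _
      obtain ⟨t, rfl⟩ := hι γ
      exact ⟨x, t, (map_conj_smul D.ιX t _).symm⟩
    · rintro ⟨x', t, he⟩
      rw [he]
      exact Subgroup.map_le_range _ _
  conj_eq_iff _ γ := by
    constructor
    · rintro -
      obtain ⟨t, rfl⟩ := hι γ
      exact Subgroup.conj_smul_eq_self_of_mem ⟨t, rfl⟩
    · intro heq
      obtain ⟨x⟩ := ‹Nonempty D.Cusp›
      refine ⟨x, 1, ?_⟩
      rw [map_one, one_smul, heq]
      exact Subgroup.map_le_range _ _

end StableCurveTemperedData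

namespace StableCurveTemperedData

open Pointwise

/-- **F-2603, CLOSED INSTANCE (0 binders) at a toy carrier, labelled**: the degenerate inhabitant of the interface
used by the closure refuter `not_forall_cor25Inertia` — `Π^tp = Π̂ = ℤ/2ℤ` (graph and curve level, `ι = id`,
discrete), `G_k = 1`, `Σ = {3}`, `Σ̂ = Primes`, `p = 2`, `Π^tp_ℍ = 1`, `Π̂_ℍ = ℤ/2ℤ` — but WITH ONE CUSP
(`Cusp := PUnit`, `I_x := Δ^tp_X`) SATISFIES [IUTchI] Cor. 2.5 (inertia part) as typed, by
`cor25Inertia_of_ιX_surjective` (`ι = id` is onto).  DEGENERATE toy; not the printed corollary.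
[claim: Mochizuki2012, status: disputed] -/
theorem cor25Inertia_toyDatum :
    Literature.IUT.HodgeTheaters.StableCurveTemperedData.Cor25Inertia
      ({ graph :=
          { Sigma := {3}
            SigmaHat := {q | q.Prime}
            sigma_subset := fun q hq => by
              rw [Set.mem_singleton_iff] at hq
              subst hq
              exact Nat.prime_three
            sigma_nonempty := ⟨3, rfl⟩
            sigmaHat_prime := fun _ hq => hq
            Tp := Multiplicative (ZMod 2)
            Hat := Multiplicative (ZMod 2)
            ι := MonoidHom.id _
            ι_continuous := continuous_id
            ι_injective := fun _ _ h => h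
            TpH := ⊥
            HatH := ⊤
            tpH_le := le_top }
         p := 2
         p_notMem := by
           show (2 : ℕ) ∉ ({3} : Set ℕ)
           simp
         PiTp := Multiplicative (ZMod 2)
         PiHat := Multiplicative (ZMod 2)
         Gk := Multiplicative (ZMod 1)
         ιX := MonoidHom.id _
         ιX_continuous := continuous_id
         ιX_injective := fun _ _ h => h
         prTp := 1
         prHat := 1
         prTp_surjective := fun _ => ⟨1, Subsingleton.elim _ _⟩
         prHat_comp := by ext; exact Subsingleton.elim _ _
         ρTp := (1 : Multiplicative (ZMod 2) →* Multiplicative (ZMod 1)).ker.subtype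
         ρHat := (1 : Multiplicative (ZMod 2) →* Multiplicative (ZMod 1)).ker.subtype
         ρTp_surjective := fun x => ⟨⟨x, by simp⟩, rfl⟩
         ρHat_surjective := fun x => ⟨⟨x, by simp⟩, rfl⟩
         ρ_comp := fun _ => rfl
         Cusp := PUnit
         inertiaTp := fun _ => ⊤
         cuspMeetsH := fun _ => True
         Pt := PUnit
         decompTp := fun _ => ⊤ } : StableCurveTemperedData.{0}) :=
  @cor25Inertia_of_ιX_surjective _ (fun y => ⟨y, rfl⟩) ⟨PUnit.unit⟩

/-- **R5 record for F-2603**: [IUTchI] Cor. 2.5 (inertia part) as typed HOLDS at some datum (the toy datum with a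
cusp above) and its universal closure FAILS (`not_forall_cor25Inertia`, the same carrier without cusps): consumable
at named instances only. [claim: Mochizuki2012, status: disputed] -/
theorem exists_cor25Inertia_and_not_forall :
    (∃ D : StableCurveTemperedData.{0}, Literature.IUT.HodgeTheaters.StableCurveTemperedData.Cor25Inertia D) ∧
      ¬ ∀ D : StableCurveTemperedData.{0}, Literature.IUT.HodgeTheaters.StableCurveTemperedData.Cor25Inertia D :=
  ⟨⟨_, cor25Inertia_toyDatum⟩, not_forall_cor25Inertia⟩

end StableCurveTemperedData

end Literature.IUT.HodgeTheaters
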